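import Mathlib
import HarnessLib
import HarnessLib.Audit
import Summits.Parity.Statement
import Literature.NumberTheory.Sieve.SingularSeries

/-!
Route: LeeYangRoughCells

CLOSED (retired) 2026-08-15T13:50:02Z by operator:999:1257524 — reason: not-a-thesis: assembly does not conclude the sub-problem Statement — note: D-0027 §2.1 audit (human 2026-08-15: routes that do not decide the summit are removed): the assembly concludes `PairsHL`, not the sub-problem statement; a NEW conforming route may be opened from the same idea (generated `closes : … → _root_.GeneralizedHardyLittlewood`).. The file is kept as the record of this route; refuted decls are indexed as negative knowledge (`ledger negatives`).

# Route LeeYangRoughCells — hyperbolicity of the rough-cell polynomial of p+h clips Bombieri's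
parity parameter to zero

It suffices to show X = A ∧ H (plus two provable-now supports). Fix an even shift h and u ≥ 2 and
resolve the shifted primes into ROUGH CELLS N_j(x) := Σ_{p ≤ x, P⁻(p+h) > x^{1/u}, Ω(p+h) = j} log p
(N₁ = the Λ-weighted prime-pair count), with model cells A_j(x) := #{n ≤ x : P⁻(n) > x^{1/u}, Ω(n) =
j}. A (ALPHA LAW, crux 3): one function θ = θ_{h,u}(x) governs every cell, N_j(x) = (1 +
(−1)^{j+1}θ(x))·𝔖({0,h})·A_j(x) + o(x/log x) — Bombieri's one-parameter indeterminacy, typed EH-free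
(EH ⟹ A by the asymptotic sieve; HL(h) is θ → 0). H (ROUGH-CELL HYPERBOLICITY, crux 2, card
lee-yang-circle-prime-factors C2): for cofinally many u and all large x the cell polynomial
R_{x,h,u}(z) = Σ_j N_j(x) z^j has only real zeros. Newton's inequalities turn H into log-concavity
of (N_j)_j, and an alternating modulation (1 ± θ) of the model sequence (A_j)_j — whose
log-concavity ratios tend to 1 in the bulk (support ModelMarginsVanish) — stays log-concave only if
θ → 0 (the θ-clipping of card log-concavity-kills-parity); hence N₁(x) ~ 𝔖(h) x/log x and PairsHL
(support PrimeCellToPairsHL). Cards realised: lee-yang-circle-prime-factors (spine: zero locus as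
the parity-sensitive input; its S3 = crux ModelHyperbolicity), log-concavity-kills-parity (the
shape-inequality consumer).
Lean: `RoughCellAlphaLaw ∧ RoughCellHyperbolicity`

## Assembly
Bookkeeping, provable now from the four hypotheses (all o's at fixed h, u). Fix h; for odd h the
hypothesis of PrimeCellToPairsHL holds trivially (𝔖({0,h}) = 0, only p = 2 can contribute). For even
h and ε > 0: ModelMarginsVanish gives u₀; RoughCellHyperbolicity gives u ≥ u₀ and real-rootedness of
R_{x,h,u} for x ≥ x₀; ModelMarginsVanish at this u gives j₁ (odd) and j₂ (even); RoughCellAlphaLaw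
at (h,u) gives θ. Positivity N₁, N₂ ≥ 0 with A₁, A₂ ≫ x/log x (Chebyshev; u > j₁ ≥ 3) forces −1 −
o(1) ≤ θ(x) ≤ 1 + o(1). A real-rooted polynomial with non-negative coefficients has log-concave
coefficients (Newton), so N_j² ≥ N_{j−1}N_{j+1} at j = j₁, j₂; inserting the α-law (cells j ± 1
carry the sign opposite to cell j; divide by A_j² ≥ c²x²/log²x, bound A_{j±1} ≤ Φ(x, x^{1/u}) =
O(x/log x) by the tree's Buchstab asymptotic) and the margin gives (1 + s_jθ)² ≥ (1 − ε)(1 − s_jθ)²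
− o(1) with s_j = (−1)^{j+1}, i.e. s_jθ ≥ −(1 − √(1−ε))/(1 + √(1−ε)) − o(1); j₁ odd yields the lower
and j₂ even the upper bound, so limsup |θ(x)| ≤ ε. With A₁(x) = π(x) − π(x^{1/u}) ~ x/log x (PNT,
tree) and N₁ = (1 + θ)𝔖A₁ + o(x/log x), and N₁ differing from Σ_{p ≤ x, p+h prime} log p by
O(x^{1/u} log x): Σ_{p ≤ x, p+h prime} log p = 𝔖 x/log x + O(ε x/log x) + o(x/log x) for every ε,
hence ~ 𝔖(h) x/log x for every h, and PrimeCellToPairsHL concludes PairsHL. Full GHL additionally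
needs k-tuples and uniform shifts (route DicksonFibration) — not claimed here.

Rationale: WHY THIS LINE. Mechanism: treat R = Σ_j N_j z^j as a partition function with a fugacity per prime
factor and use its ZERO LOCUS, not its values, as the non-Type-I input (LeeYang1952,
HeilmannLieb1972, BorceaBranden2009; toolbox arXiv:1410.6601, arXiv:1210.3231): hyperbolicity is
preserved by rich operator classes and proved by interlacing along recursions — a proof technology
never pointed at sieve cells — and both Selberg phases θ = ±1 are maximally non-hyperbolic (only
even resp. odd powers survive, zeros on iℝ), so H is parity-sensitive by design and lies outside the
deduction class of Literature.Barriers.Parity.SelbergParityBarrier / PrimePairParity. The Type-I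
side is Bombieri's asymptotic sieve (BombieriAsymptoticSieve1976; Bombieri 1989 survey,
book:editor1989-number-theory-trace-formulas-discrete-groups PDF pp.39–40: general weights T₁^± = W⁺
± |W⁻|, asymptotics iff W⁻ = 0; Friedlander2006ProducingPrimes p.21: odd-Ω weight = α × expected),
whose Λ_k-form for Λ(n+2) under EH is PROVED in the tree
(Literature.NumberTheory.Sieve.bombieri_asymptotic_sieve_shiftedPrimes_holds); the cell-resolved
α-law is filed EH-free as crux 3 so that no unproved cone fact is imported and the route stays
servable. The model side is anatomy of rough integers (Buchstab ω: tree BuchstabFunction.lean and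
RoughNumbersBuchstab*.lean, proved; Alladi1982; Tenenbaum2015 III.6): A_j(x) ~ I_j(u) x/log x with
I₁ = 1, ∂_u I_j(u) = I_{j−1}(u−1)/(u−1), Σ_j I_j = uω(u), and r_j(u) = I_j²/(I_{j−1}I_{j+1}) →
j/(j−1) as u → ∞ for fixed j, so the margins vanish in the bulk (provable now). Imported areas:
statistical mechanics of zeros with an explicit dictionary (spins 1_{q|n}, fugacity z, condensation
at z = P⁻, Fisher zeros from 1/Γ: Kowalski–Nikeghbali arXiv:0905.0318), total positivity /
real-rootedness from combinatorics, the asymptotic sieve. What prior routes do not do: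
MobiusShiftedPrimes asks for a Möbius ASYMPTOTIC (Bombieri's k = 1 residual), ParityCorner and
TauberianTwins for analytic bounds or Tauberian rigidity of VALUES; here the extra input is a
zero-locus (shape) statement — its log-concavity shadow has multiplicative slack r_j ≈ 3.8 at the
model (u = 6) and holds on a neighbourhood of the Hardy–Littlewood world, while full hyperbolicity
is tight (θ*(6) ≈ 0.02, kit j000121) — and the route carries a parity-free structural crux
(ModelHyperbolicity) that can be settled independently. Negatives index empty (2026-08-15).

RANKED CRUXES. #0 PairsHL (target) — Hardy–Littlewood pairs, Λ-form, fixed shift: for every h ≥ 1,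
Σ_{n ≤ N} Λ(n)Λ(n+h) = 𝔖({0,h}) N + o(N) — the d = 1, t = 2, fixed-shift content of GHL; same decl
text as stmt-Parity-0867 (shared with ParityCorner, TauberianTwins). (why it might fail: Binary HL
(1923 Conj. B), fixed even h: open, twin-prime strength; parity blocks sieve deductions even under
EH (Literature.Barriers.Parity.PrimePairParity); Siegel-sensitive only in its shift-uniform form.)
[HardyLittlewood1923, GreenTao2010, BombieriAsymptoticSieve1976]
#2 RoughCellHyperbolicity (crux) — (card lee-yang-circle-prime-factors C2 = H(u), cofinal form,
which is all the Assembly uses) for every even h ≥ 2 and every u₀ there are u ≥ u₀ and x₀ such that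
for all x ≥ x₀ every zero of R_{x,h,u}(z) = Σ_{j ≤ u} N_j(x) z^j is real, N_j(x) = Σ_{p ≤ x prime,
P⁻(p+h) > x^{1/u}, Ω(p+h) = j} log p. Numerics (card): x = 4·10⁶, h = 2: u = 6 zeros −1.085, −2.82,
−10.6, −23.6; u = 5: −1.12, −4.21, −38.4 — all real. Calibration (kit j000121): the model stays
hyperbolic under the alternating deformation F(u,z) − θF(u,−z) only for |θ| ≤ θ*(u) ≈ 0.175, 0.055,
0.020, 0.010 at u = 4, 5, 6, 7 and θ*(u) < 0.005 for u ≥ 8 — so, given the α-law, H at one moderate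
u already pins the prime-pair count to within a few per cent of HL; the log-concavity consequences
used by the Assembly have the larger slack b_j(u) (0.32 at u = 6, 0.09 at u = 20, 0.06 at u = 30).
[difficulty: open-problem] (why it might fail: Given the α-law it is |θ_h(x)| ≤ θ*(u)+o(1) with
θ*(6) ≈ 0.02 and θ*(u) < 0.005 for u ≥ 8 (kit j000121): a zero-locus restatement of HL-strength
parity content with almost no slack and no sieve proof (Selberg phases put zeros on iℝ); finite-x
numerics are noise-limited (1/log x ≫ θ*).) [LeeYang1952, HeilmannLieb1972, doi:10.1007/BF01877590,
BorceaBranden2009, arXiv:1410.6601, arXiv:1210.3231, Friedlander2006ProducingPrimes,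
Literature.Barriers.Parity.SelbergParityBarrier, Literature.Barriers.Parity.PrimePairParity,
card:lee-yang-circle-prime-factors]
#3 RoughCellAlphaLaw (crux) — (Bombieri's one-parameter law for the rough cells of shifted primes,
EH-free typing) for every even h ≥ 2 and u ≥ 2 there is θ : ℕ → ℝ with N_j(x) = (1 +
(−1)^{j+1}θ(x))·𝔖({0,h})·A_j(x) + o(x/log x) for every 1 ≤ j ≤ u, A_j(x) = #{n ≤ x : P⁻(n) >
x^{1/u}, Ω(n) = j}. Known: EH ⟹ it (Bombieri's balanced general weights + FI1978 Example 1, the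
latter proved in tree as isBombieriSequence_shiftedPrimesCounting_two); HL alone does not give the
cells j ≥ 2. [difficulty: XL] (why it might fail: Known only from level-1 Type-I data (EH ⟹ it via
Bombieri's general-weights theorem, printed for smooth anatomy weights: cell indicators need a
sandwich); unconditionally it is a fixed-u asymptotic rigidity of Chen-type cells of p+h that
level-1/2 data cannot force (Ford2004).) [BombieriAsymptoticSieve1976,
book:editor1989-number-theory-trace-formulas-discrete-groups, Friedlander2006ProducingPrimes,
FriedlanderIwaniecPisa1978, Literature.NumberTheory.Sieve.bombieri_asymptotic_sieve_shiftedPrimes,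
Literature.Barriers.Parity.FordFixedLevelBarrier, Ford2004, zbl:0758.11038]
#4 ModelHyperbolicity (crux) — (card S3, finite form; parity-free; the model case and cheapest
falsifier of crux 2, not used by the Assembly) for every u ≥ 2 and all large x the rough-integer
cell polynomial Σ_{j ≤ u} A_j(x) z^j has only real zeros. Up to simplicity of zeros this is: the
Buchstab–Dickman cell polynomial F(u,z) = Σ_j I_j(u) z^j (I₁ = 1, ∂_u I_j = I_{j−1}(u−1)/(u−1), Σ_j
I_j = uω(u)) is real-rooted for every u; its small zeros tend to 0, −1, −2, … as u → ∞ (Γ-zeros). By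
hand: u ≤ 5 (degree ≤ 3) real-rooted since log²(u−1) > 4I₃(u) on (3,5]; kit job j000121 (this
session): F(u,·)/z has only real simple zeros for every u ∈ {2.5, 3, …, 30} (degrees 1–28).
[difficulty: L] (why it might fail: Parity-free; numerically all zeros of F(u,·) are real and simple
for u ∈ [2.5, 30] (kit j000121, grid 10⁻³, exact Sturm), but nothing is proved beyond degree 3, no
interlacing along the Buchstab recursion is known, and one complex pair at one u (u > 30 or hidden
by the grid) refutes it as stated.) [Tenenbaum2015, Alladi1982, doi:10.1093/qmath/33.2.129,
Literature.NumberTheory.Sieve.buchstabOmega, Lichtman2025LinearSieve, Selberg1954, arXiv:0905.0318,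
arXiv:1410.6601, card:lee-yang-circle-prime-factors]
#9 ModelMarginsVanish (support) — for every ε > 0 and all large u there are an odd j₁ and an even j₂
in [2, u) and c > 0 such that for all large x and j ∈ {j₁, j₂}: A_j(x) ≥ c·x/log x and (1 −
ε)A_j(x)² ≤ A_{j−1}(x)A_{j+1}(x) (the model's log-concavity ratios tend to 1 in the bulk: for fixed
j, A_j(x) ~ I_j(u) x/log x and I_j(u) ~ (log u)^{j−1}/(j−1)! as u → ∞, so r_j(u) → j/(j−1); take j₁,
j₂ > 1 + 2/ε, then u large, then x large; inputs PNT and Buchstab asymptotics, both in tree).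
[difficulty: provable-now] [Tenenbaum2015, Alladi1982, GranvilleSoundararajan2007,
Literature.NumberTheory.Sieve.buchstabOmega, Lichtman2025LinearSieve]
#9 PrimeCellToPairsHL (support) — (glue, partial summation) if for every h ≥ 1, Σ_{p ≤ x, p+h prime}
log p = 𝔖({0,h}) x/log x + o(x/log x), then PairsHL: prime powers contribute O(√N log²N), log(p+h) =
log N + O(log(N/p)) is absorbed by partial summation; for odd h both sides are trivial (𝔖({0,h}) =
0, only p = 2 contributes). [difficulty: provable-now] [HardyLittlewood1923, MontgomeryVaughan2007,
Literature.NumberTheory.Sieve.singularSeries]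

TWO-LAYER PLAN. Foreseen glued splits (k ≤ 3, depth 1), none filed now. RoughCellAlphaLaw ⇐ [EH →
RoughCellAlphaLaw: vendoring Bombieri's balanced general weights over the tree's IsBombieriSequence
machinery, with a smooth sandwich of the cell indicators] → [EH carried as a named hypothesis] →
RoughCellAlphaLaw — the conditional reading, to be split in only if the planner accepts EH in the
cone. RoughCellHyperbolicity ⇐ [H(u) for u ≤ 6, all even h: with the α-law this alone gives prime
pairs at every even gap with ≥ (1 − b₃(6)) ≈ 0.69 of the HL density, the LC card's deliverable] →
[H(u) for cofinal u > 6] → RoughCellHyperbolicity. ModelHyperbolicity ⇐ [F(u,·) real-rooted with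
simple zeros for every u] → [A_j(x) ~ I_j(u) x/log x for j < u, then Hurwitz] → ModelHyperbolicity.

KILL CRITERIA. ModelHyperbolicity refuted at isolated u (a certified complex pair of F(u,·)) ⇒
restate crux 4 to the surviving range (crux 2 is cofinal and survives) — pivot, not close; complex
pairs of F(u,·) for ALL large u ⇒ under the α-law and HL crux 2 is false: close
`refuted:RoughCellHyperbolicity` (the zero-locus form is dead; the weaker LC-window form reverts to
card log-concavity-kills-parity). RoughCellAlphaLaw refuted for some (h,u,j) ⇒ it would refute EH
via Bombieri, so first re-check the typing (weights log p vs Λ, the cell boundary x^{1/u}, the j = u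
window (x, x+h]) and restate; genuine ⇒ close. PairsHL proved elsewhere (MobiusShiftedPrimes,
TauberianTwins, ParityCorner) moots the route; cruxes 2–4 keep stand-alone value (cell-resolved
statistics of p+h; a parity-free theorem on rough integers).

NOT DECOMPOSED YET. The EH ⟹ α-law vendoring (Bombieri [B2] general weights: smooth approximation of
cell indicators, the W⁻ = 0 asymptotic; FI1978 (A₁)–(A₅) for Λ(n+2) already proved in tree); the
card's calibration theorems T1 (circle theorem: all but O(log log x) zeros of Σ_{n≤x} z^{Ω(n)}
converge to |z| = 2, equidistributed) and T2 (W-tricked Σ μ²(n) z^{ω(n)}: zeros in |z| < R converge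
to 0, −1, −2, … by Selberg–Delange (Tenenbaum2015 II.5–6) + Hurwitz) — no bearing on PairsHL,
fileable later as Literature facts; the shifted-prime ladder C1 (zero of Q_{x,2} nearest −k tends to
−k ⟺ k-th order parity cancellation on p+2; k = 1 sharpens MobiusShiftedPrimes' atom
stmt-Parity-0612) — a probe, not load-bearing; the two-point (GEH) checkerboard version; the EH-free
LP programme over Ford's fixed-level slack (LC card Crux 3); any uniformity in h (false in the
illusory Siegel world; not claimed); constants θ*(u) (hyperbolicity thresholds of F(u,z) − θF(u,−z))
versus the LC clippings b_j(u).

CHEAPEST FALSIFIER. RUN this session (kit job j000121, 56 s, pure python): F(u,z) = Σ_j I_j(u) z^j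
on a grid (I₁ ≡ 1; I_j(u) = ∫_j^u I_{j−1}(v−1)/(v−1) dv, cumulative trapezoid, step 10⁻³; sanity Σ_j
I_j(20)/20 = 0.561459 = e^{−γ} ✓, I₂ = log(u−1) ✓), real zeros counted by an exact Sturm sequence on
the float polynomial: F(u,·)/z is real-rooted with simple zeros for EVERY u ∈ {2.5, 3.0, …, 30.0}
(degrees 1…28) — ModelHyperbolicity survives its cheapest test; min_j r_j(u) = 3.79, 2.10, 1.45,
1.28 at u = 6, 10, 20, 30 (margins vanish as predicted); hyperbolicity thresholds θ*(u) of F(z) −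
θF(−z): 0.175 (u=4), 0.055 (5), 0.020 (6), 0.010 (7), < 0.005 (u ≥ 8). Next cheapest: (i) extend to
u ≤ 100 with a finer grid near integers and certified (interval) root isolation — a complex pair
kills crux 4 as stated and, given the α-law and HL, H(u) there; complex pairs for all large u kill
crux 2; (ii) finite-x cells N_j for p ≤ 10⁹, h ∈ {2, 6, 30}: real-rootedness of R_{x,h,u} is
informative only for u ≤ 7 (θ*(u) above the 1/log x coefficient noise); for larger u compare instead
the per-cell parity readings θ_j(x) := (−1)^{j+1}(N_j/(𝔖A_j) − 1) across j (the α-law predicts one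
common value, HL predicts → 0).

NUMBERS. Model cell densities (kit j000121): u = 6: I_j = 1, 1.609, 0.684, 0.0748, 0.00087 (j =
1…5), r₂, r₃, r₄ = 3.79, 3.89, 9.35 (finite-x rough integers at 4·10⁶, card: 4.08, 3.60, 4.37 — top
cells converge slowly); u = 10: I_j = 1, 2.197, 1.706, 0.603, 0.101, 0.0076, 2.0e−4, 1.2e−6,
2.7e−10, min r_j = 2.10 (j = 4); u = 20: min r_j = 1.446 (j = 7, 8); u = 30: min r_j = 1.277 (j =
11); r_j(u) → j/(j−1) for fixed j. Clippings b_j = (1 − r_j^{−1/2})/(1 + r_j^{−1/2}): ≈ 0.32 (u =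
6), 0.19 (10), 0.092 (20), 0.061 (30) ⇒ e.g. H(6) ∧ α-law ⇒ 0.68·HL ≤ twins ≤ 1.32·HL via Newton
alone, and |twins/HL − 1| ≤ θ*(6) ≈ 0.02 via full hyperbolicity. Zeros at x = 4·10⁶, h = 2, u = 6:
−1.085, −2.82, −10.6, −23.6 (p+2) vs −1.06, −3.08, −9.41, −32.1 (rough integers ≤ x); F(5,z)/z = 1 +
1.386z + 0.406z² + 0.0149z³ (zeros ≈ −1.0, −2.7, −24). Selberg phases: θ = −1 ⇒ R(z) even, θ = +1 ⇒
R(z)/z even — zeros on iℝ. Buchstab ω(u) → e^{−γ} = 0.5615. Items at open: 7 (3 cruxes, 2 supports,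
target, assembly).

DEFINITION REQUESTS. None needed to open: cells are inlined with Mathlib's Nat.minFac and
ArithmeticFunction.cardFactors, 𝔖 = Literature.NumberTheory.Sieve.singularSeries, Buchstab ω =
Literature.NumberTheory.Sieve.buchstabOmega. A Literature definition of the generalised Buchstab
cell densities I_j(u) (topic Literature/NumberTheory/Sieve, next to BuchstabFunction.lean) would
shorten the proofs of ModelHyperbolicity / ModelMarginsVanish; provers may introduce it with
--supports.

Novelty: Searches (2026-08-15): `lit frontier Parity --since 2020` (30 rows: nothing on zero loci of
prime-factor polynomials or on the shape of almost-prime cells); `lit bridges Parity --cross any`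
(30 generic monographs/surveys); `lit search --hybrid` ×3 — "Bombieri asymptotic sieve parity odd
number of prime factors alpha" (12 books: Friedlander LNM1891 p.21 and Bombieri 1989 pp.39–40 READ),
"real zeros polynomial number of prime factors sifted integers log-concavity" (textbook noise only),
Ω-laws of sifted integers (`--source all`: searchd rc 75, recorded as not consulted); `lit galaxy
search --star all` ×5 substring ("primon gas": 1 irrelevant physics preprint; "integers free of
small prime factors": 1 irrelevant; "real-rooted"+"prime factors", "sieve of
Eratosthenes"+"Erdos-Kac", Lee–Yang+prime factors: 0) and `--star pdf --mode intelligent` on local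
laws of Ω on sifted integers (10 hits: Dartyge's friable survey, Granville–Soundararajan 'Sieving
and the Erdős–Kac theorem', Elliott 'Ramifications', Kubilius — moments/CLT only, no real-rootedness
or log-concavity statement); the card's own audited searches (galaxy intelligent ×2 → only
arXiv:1410.6601, arXiv:1210.3231; Spector/Julia primon gas; Kowalski–Nikeghbali arXiv:0905.0318);
audits of the retired cards parity-rigidity-bombieri-class and one-function-parity-law READ (α-law =
Bombieri's theorem under level 1); the seven route files of the sub and all 46 open cards scanned by
mechanism line.
Nearest prior art found: BombieriA  [refs: 1410.6601, 1210.3231, 0905.0318, book:editor1989-number-theory-trace-formulas-discrete-groups, BombieriAsymptoticSieve1976, LeeYang1952, BorceaBranden2009]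

Barriers (technique_class: lee-yang-zeros, hyperbolicity, asymptotic-sieve): - technique_class: lee-yang-zeros, hyperbolicity, asymptotic-sieve
- Literature.Barriers.Parity.SelbergParityBarrier: not evaded by Type-I means and not claimed to be
— crux 2 is parity-sensitive by construction (θ = −1 leaves an even polynomial, θ = +1 an odd one:
zeros on iℝ, maximally non-hyperbolic), hence underivable from level-of-distribution axioms; it is
the declared extra input, to be proved, if at all, from zero-locus structure (interlacing, stability
preservers), never from sieve bounds.
- Literature.Barriers.Parity.PrimePairParity: same accounting — H is not a
weight-insertion-invariant sieve deduction; the Assembly uses Bombieri's α-law as bookkeeping and H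
as the non-sieve hypothesis (Polymath8b §8: some non-sieve input is needed — budgeted, not
circumvented).
- Literature.Barriers.Parity.FordFixedLevelBarrier: bites on crux 3 — the α-law needs level x^{1−ε}
for every ε (EH ⟹ it); a fixed level ν < 1 cannot force cell asymptotics (Ford's sequences); no
unconditional proof of crux 3 from BV is claimed (its why-might-fail says so).
- Literature.Barriers.Parity.LargeSieveLevelHalf: EH is imported into NO statement; it is only the
known sufficient condition for crux 3. Conceded: proving crux 3 today means assuming EH.
- Literature.Barriers.Parity.LinearSieveOptimality: consistent — Selberg's extremal sets (rough
integers with Ω odd / even) are exactly the two non-hyperbolic phases; H excludes them by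
hypothesis, it does not beat F, f.
- Literature.Barriers.Parity.Si

History (route lifecycle, newest last):
- 2026-08-15T13:50:02Z · CLOSED retired — not-a-thesis: assembly does not conclude the sub-problem Statement (operator:999:1257524)

sub-problem: GeneralizedHardyLittlewood · status: closed(retired) · opened planner-plancard-Parity-GeneralizedHardyLittl-fda775fa-0 2026-08-15T12:20:18Z · rev 0 · ledger route-Parity-LeeYangRoughCells
GENERATED by the gate from the ledger (D-0016/17). Provers cite these decls: `theorem foo : Summit.Parity.GeneralizedHardyLittlewood.Theses.LeeYangRoughCells.<Decl> := …` in Summits/Parity/GeneralizedHardyLittlewood/Theorems/<Name>.lean.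
-/

namespace Summit.Parity.GeneralizedHardyLittlewood.Theses.LeeYangRoughCells

open scoped BigOperators Topology Manifold Classical MeasureTheory ProbabilityTheory Matrix InnerProductSpace ComplexConjugate ContinuousMap
open Filter Set Function TopologicalSpace MeasureTheory

attribute [summit_statement] _root_.GeneralizedHardyLittlewood

/-- item stmt-Parity-0867 · target · rank 0 · closed · moot by None · by planner
why it might fail: Binary HL (1923 Conj. B), fixed even h: open, twin-prime strength; parity blocks sieve deductions even under EH (Literature.Barriers.Parity.PrimePairParity); Siegel-sensitive only in its shift-uniform form.
sources: HardyLittlewood1923, GreenTao2010, BombieriAsymptoticSieve1976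
[target] Hardy–Littlewood pairs, Λ-form, fixed shift: for every h ≥ 1, ∑_{n ≤ N} Λ(n)Λ(n+h) =
𝔖({0,h}) N + o(N). The d = 1, t = 2, fixed-shift content of GHL (uniformity in h ≤ L N is NOT
claimed here; see route DicksonFibration). Open. [HardyLittlewood1923] [GreenTao2010, Example 1] -/
@[route_item "route-Parity-LeeYangRoughCells"]
def PairsHL : Prop :=
  ∀ h : ℕ, 1 ≤ h → (fun N : ℕ => ∑ n ∈ Finset.Icc 1 N, ArithmeticFunction.vonMangoldt n * ArithmeticFunction.vonMangoldt (n + h) - Literature.NumberTheory.Sieve.singularSeries ({0, (h : ℤ)} : Finset ℤ) * N) =o[Filter.atTop] fun N : ℕ => (N : ℝ)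

/-- item stmt-Parity-7942 · crux · rank 2 · closed · moot by None · by planner
why it might fail: Given the α-law it is |θ_h(x)| ≤ θ*(u)+o(1) with θ*(6) ≈ 0.02 and θ*(u) < 0.005 for u ≥ 8 (kit j000121): a zero-locus restatement of HL-strength parity content with almost no slack and no sieve proof (Selberg phases put zeros on iℝ); finite-x numerics are noise-limited (1/log x ≫ θ*).
sources: LeeYang1952, HeilmannLieb1972, doi:10.1007/BF01877590, BorceaBranden2009, arXiv:1410.6601, arXiv:1210.3231
[crux] (card lee-yang-circle-prime-factors C2 = H(u), cofinal form, which is all the Assembly uses)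
for every even h ≥ 2 and every u₀ there are u ≥ u₀ and x₀ such that for all x ≥ x₀ every zero of
R_{x,h,u}(z) = Σ_{j ≤ u} N_j(x) z^j is real, N_j(x) = Σ_{p ≤ x prime, P⁻(p+h) > x^{1/u}, Ω(p+h) = j}
log p. Numerics (card): x = 4·10⁶, h = 2: u = 6 zeros −1.085, −2.82, −10.6, −23.6; u = 5: −1.12,
−4.21, −38.4 — all real. Calibration (kit j000121): the model stays hyperbolic under the alternating
deformation F(u,z) − θF(u,−z) only for |θ| ≤ θ*(u) ≈ 0.175, 0.055, 0.020, 0.010 at u = 4, 5, 6, 7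
and θ*(u) < 0.005 for u ≥ 8 — so, given the α-law, H at one moderate u already pins the prime-pair
count to within a few per cent of HL; the log-concavity consequences used by the Assembly have the
larger slack b_j(u) (0.32 at u = 6, 0.09 at u = 20, 0.06 at u = 30). [difficulty: open-problem] -/
@[route_item "route-Parity-LeeYangRoughCells"]
def RoughCellHyperbolicity : Prop :=
  ∀ h : ℕ, 1 ≤ h → Even h → ∀ u₀ : ℕ, ∃ u : ℕ, u₀ ≤ u ∧ ∃ x₀ : ℕ, ∀ x : ℕ, x₀ ≤ x → ∀ z : ℂ, (∑ j ∈ Finset.range (u + 1), ((∑ p ∈ Finset.filter Nat.Prime (Finset.Icc 1 x), if ((x : ℝ) ^ ((1 : ℝ) / u) < (Nat.minFac (p + h) : ℝ) ∧ ArithmeticFunction.cardFactors (p + h) = j) then Real.log p else 0 : ℝ) : ℂ) * z ^ j) = 0 → z.im = 0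

/-- item stmt-Parity-7943 · crux · rank 3 · closed · moot by None · by planner
why it might fail: Known only from level-1 Type-I data (EH ⟹ it via Bombieri's general-weights theorem, printed for smooth anatomy weights: cell indicators need a sandwich); unconditionally it is a fixed-u asymptotic rigidity of Chen-type cells of p+h that level-1/2 data cannot force (Ford2004).
sources: BombieriAsymptoticSieve1976, book:editor1989-number-theory-trace-formulas-discrete-groups, Friedlander2006ProducingPrimes, FriedlanderIwaniecPisa1978, Literature.NumberTheory.Sieve.bombieri_asymptotic_sieve_shiftedPrimes, Literature.Barriers.Parity.FordFixedLevelBarrier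
[crux] (Bombieri's one-parameter law for the rough cells of shifted primes, EH-free typing) for
every even h ≥ 2 and u ≥ 2 there is θ : ℕ → ℝ with N_j(x) = (1 + (−1)^{j+1}θ(x))·𝔖({0,h})·A_j(x) +
o(x/log x) for every 1 ≤ j ≤ u, A_j(x) = #{n ≤ x : P⁻(n) > x^{1/u}, Ω(n) = j}. Known: EH ⟹ it
(Bombieri's balanced general weights + FI1978 Example 1, the latter proved in tree as
isBombieriSequence_shiftedPrimesCounting_two); HL alone does not give the cells j ≥ 2. [difficulty:
XL] -/
@[route_item "route-Parity-LeeYangRoughCells"]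
def RoughCellAlphaLaw : Prop :=
  ∀ h : ℕ, 1 ≤ h → Even h → ∀ u : ℕ, 2 ≤ u → ∃ θ : ℕ → ℝ, ∀ j : ℕ, 1 ≤ j → j ≤ u → (fun x : ℕ => (∑ p ∈ Finset.filter Nat.Prime (Finset.Icc 1 x), if ((x : ℝ) ^ ((1 : ℝ) / u) < (Nat.minFac (p + h) : ℝ) ∧ ArithmeticFunction.cardFactors (p + h) = j) then Real.log p else 0) - (1 + (-1 : ℝ) ^ (j + 1) * θ x) * Literature.NumberTheory.Sieve.singularSeries ({0, (h : ℤ)} : Finset ℤ) * (((Finset.Icc 1 x).filter (fun n => (x : ℝ) ^ ((1 : ℝ) / u) < (Nat.minFac n : ℝ) ∧ ArithmeticFunction.cardFactors n = j)).card : ℝ)) =o[Filter.atTop] fun x : ℕ => (x : ℝ) / Real.log x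

/-- item stmt-Parity-7944 · crux · rank 4 · closed · moot by None · by planner
why it might fail: Parity-free; numerically all zeros of F(u,·) are real and simple for u ∈ [2.5, 30] (kit j000121, grid 10⁻³, exact Sturm), but nothing is proved beyond degree 3, no interlacing along the Buchstab recursion is known, and one complex pair at one u (u > 30 or hidden by the grid) refutes it as stated.
sources: Tenenbaum2015, Alladi1982, doi:10.1093/qmath/33.2.129, Literature.NumberTheory.Sieve.buchstabOmega, Lichtman2025LinearSieve, Selberg1954
[crux] (card S3, finite form; parity-free; the model case and cheapest falsifier of crux 2, not used
by the Assembly) for every u ≥ 2 and all large x the rough-integer cell polynomial Σ_{j ≤ u} A_j(x)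
z^j has only real zeros. Up to simplicity of zeros this is: the Buchstab–Dickman cell polynomial
F(u,z) = Σ_j I_j(u) z^j (I₁ = 1, ∂_u I_j = I_{j−1}(u−1)/(u−1), Σ_j I_j = uω(u)) is real-rooted for
every u; its small zeros tend to 0, −1, −2, … as u → ∞ (Γ-zeros). By hand: u ≤ 5 (degree ≤ 3)
real-rooted since log²(u−1) > 4I₃(u) on (3,5]; kit job j000121 (this session): F(u,·)/z has only
real simple zeros for every u ∈ {2.5, 3, …, 30} (degrees 1–28). [difficulty: L] -/
@[route_item "route-Parity-LeeYangRoughCells"]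
def ModelHyperbolicity : Prop :=
  ∀ u : ℕ, 2 ≤ u → ∃ x₀ : ℕ, ∀ x : ℕ, x₀ ≤ x → ∀ z : ℂ, (∑ j ∈ Finset.range (u + 1), ((((Finset.Icc 1 x).filter (fun n => (x : ℝ) ^ ((1 : ℝ) / u) < (Nat.minFac n : ℝ) ∧ ArithmeticFunction.cardFactors n = j)).card : ℕ) : ℂ) * z ^ j) = 0 → z.im = 0

/-- item stmt-Parity-7945 · support · rank 9 · closed · moot by None · by planner
sources: Tenenbaum2015, Alladi1982, GranvilleSoundararajan2007, Literature.NumberTheory.Sieve.buchstabOmega, Lichtman2025LinearSieve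
[support] for every ε > 0 and all large u there are an odd j₁ and an even j₂ in [2, u) and c > 0
such that for all large x and j ∈ {j₁, j₂}: A_j(x) ≥ c·x/log x and (1 − ε)A_j(x)² ≤
A_{j−1}(x)A_{j+1}(x) (the model's log-concavity ratios tend to 1 in the bulk: for fixed j, A_j(x) ~
I_j(u) x/log x and I_j(u) ~ (log u)^{j−1}/(j−1)! as u → ∞, so r_j(u) → j/(j−1); take j₁, j₂ > 1 +
2/ε, then u large, then x large; inputs PNT and Buchstab asymptotics, both in tree). [difficulty:
provable-now] -/
@[route_item "route-Parity-LeeYangRoughCells"]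
def ModelMarginsVanish : Prop :=
  ∀ ε : ℝ, 0 < ε → ∃ u₀ : ℕ, ∀ u : ℕ, u₀ ≤ u → ∃ j₁ j₂ : ℕ, Odd j₁ ∧ Even j₂ ∧ 2 ≤ j₁ ∧ j₁ < u ∧ 2 ≤ j₂ ∧ j₂ < u ∧ ∃ c : ℝ, 0 < c ∧ ∃ x₀ : ℕ, ∀ x : ℕ, x₀ ≤ x → ∀ j ∈ ({j₁, j₂} : Finset ℕ), c * (x : ℝ) / Real.log x ≤ (((Finset.Icc 1 x).filter (fun n => (x : ℝ) ^ ((1 : ℝ) / u) < (Nat.minFac n : ℝ) ∧ ArithmeticFunction.cardFactors n = j)).card : ℝ) ∧ (1 - ε) * ((((Finset.Icc 1 x).filter (fun n => (x : ℝ) ^ ((1 : ℝ) / u) < (Nat.minFac n : ℝ) ∧ ArithmeticFunction.cardFactors n = j)).card : ℝ)) ^ 2 ≤ ((((Finset.Icc 1 x).filter (fun n => (x : ℝ) ^ ((1 : ℝ) / u) < (Nat.minFac n : ℝ) ∧ ArithmeticFunction.cardFactors n = j - 1)).card : ℝ)) * ((((Finset.Icc 1 x).filter (fun n => (x : ℝ)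 ^ ((1 : ℝ) / u) < (Nat.minFac n : ℝ) ∧ ArithmeticFunction.cardFactors n = j + 1)).card : ℝ))

/-- item stmt-Parity-7946 · support · rank 9 · closed · moot by None · by planner
sources: HardyLittlewood1923, MontgomeryVaughan2007, Literature.NumberTheory.Sieve.singularSeries
[support] (glue, partial summation) if for every h ≥ 1, Σ_{p ≤ x, p+h prime} log p = 𝔖({0,h}) x/log
x + o(x/log x), then PairsHL: prime powers contribute O(√N log²N), log(p+h) = log N + O(log(N/p)) is
absorbed by partial summation; for odd h both sides are trivial (𝔖({0,h}) = 0, only p = 2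
contributes). [difficulty: provable-now] -/
@[route_item "route-Parity-LeeYangRoughCells"]
def PrimeCellToPairsHL : Prop :=
  (∀ h : ℕ, 1 ≤ h → (fun x : ℕ => (∑ p ∈ Finset.filter Nat.Prime (Finset.Icc 1 x), if Nat.Prime (p + h) then Real.log p else 0) - Literature.NumberTheory.Sieve.singularSeries ({0, (h : ℤ)} : Finset ℤ) * x / Real.log x) =o[Filter.atTop] fun x : ℕ => (x : ℝ) / Real.log x) → ∀ h : ℕ, 1 ≤ h → (fun N : ℕ => ∑ n ∈ Finset.Icc 1 N, ArithmeticFunction.vonMangoldt n * ArithmeticFunction.vonMangoldt (n + h) - Literature.NumberTheory.Sieve.singularSeries ({0, (h : ℤ)} : Finset ℤ) * N) =o[Filter.atTop] fun N : ℕ => (N : ℝ)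

/-- item stmt-Parity-7947 · assembly · rank 1 · closed · moot by None · by planner
sources: BombieriAsymptoticSieve1976, arXiv:1410.6601, card:log-concavity-kills-parity
[assembly] RoughCellAlphaLaw → ModelMarginsVanish → RoughCellHyperbolicity → PrimeCellToPairsHL →
PairsHL (pure bookkeeping as above: Newton's inequalities, the sign pattern of the α-law, square
roots, ε → 0, PNT for A₁). -/
@[route_item "route-Parity-LeeYangRoughCells"]
def Assembly : Prop :=
  RoughCellAlphaLaw → ModelMarginsVanish → RoughCellHyperbolicity → PrimeCellToPairsHL → PairsHL

end Summit.Parity.GeneralizedHardyLittlewood.Theses.LeeYangRoughCells
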